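import Summits.SmoothPoincare4.SmoothPoincare4.Theorems.SullivanDualWitnessChargeReductionV9
import Literature.Geometry.Symplectic.JHolomorphicCuspGlue

/-!
# Crux `WitnessCharge` (stmt-SmoothPoincare4-7824) modulo `PencilLocalFamily` and Wendl's representation formula — reduction v10

Line `Sketch` (idea `pencil-incompleteness`), continuation lead c7, cycle 7. Since reduction v9
(`helper_witnessCharge_of_pencilLocalFamily_of_noCusp : PencilLocalFamily → F5 → WitnessCharge`,
lead c6, with F5 = `Literature.Geometry.Symplectic.jHolomorphic_immersed_of_limitEmbedded_punctured`,
McDuff 1991 Thm 1.4: no cusps in `C¹`-limits of embedded `J`-curves) the Literature side has moved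
once more: `Literature.Geometry.Symplectic.CuspDoublePoints.jHolomorphic_immersed_of_limitEmbedded_punctured_of_representationFormula`
(`Literature/Geometry/Symplectic/JHolomorphicCuspGlue.lean`, 2026-08-17 02:44Z) derives F5 from
Wendl's local representation formula with branch comparison [Wendl 2020, App. B, Thm B.23 and
(B.12)] — the hypothesis `hX` shared with
`Literature.Geometry.Symplectic.jHolomorphic_localBranchDichotomy_of_representationFormula`.
Hence the trust base of the crux on this line is now exactly

  `{PencilLocalFamily (crux stmt-SmoothPoincare4-16772), Wendl 2020 Thm B.23 (hX, verbatim)}`: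

* `helper_limitOfEmbeddedPlanes_of_representationFormula` — the route item `LimitOfEmbeddedPlanes`
  (stmt-SmoothPoincare4-16809) from `hX` alone;
* `helper_witnessCharge_of_pencilLocalFamily_of_representationFormula` — the crux from
  `PencilLocalFamily` and `hX`.

Both are one-line compositions of landed theorems; nothing new is asserted.
-/

noncomputable section

set_option linter.dupNamespace false

open scoped Manifold ContDiff Topology
open Set Filter Metric Asymptotics Function Literature.Geometry.Kaehler Literature.Geometry.Symplectic
  Literature.Topology.FourManifolds

namespace Summit.SmoothPoincare4.SmoothPoincare4.Theorems.WitnessCharge.PencilIncompleteness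

/-- **`LimitOfEmbeddedPlanes` from Wendl's representation formula alone.** The route item
`Theses.SullivanDual.LimitOfEmbeddedPlanes` (stmt-SmoothPoincare4-16809) follows from the local
representation formula with branch comparison (Wendl 2020, App. B, Thm B.23, (B.12); the hypothesis,
verbatim the `hX` of `JHolomorphicCuspGlue.lean` with `∞` spelled `((⊤ : ℕ∞) : WithTop ℕ∞)`): it gives
McDuff's no-cusp fact
(`CuspDoublePoints.jHolomorphic_immersed_of_limitEmbedded_punctured_of_representationFormula`),
which gives the item (`helper_limitOfEmbeddedPlanes_of_noCusp`, reduction v9). Registered helper stub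
of crux stmt-SmoothPoincare4-7824. -/
theorem helper_limitOfEmbeddedPlanes_of_representationFormula :
    (∀ (F : Type) [NormedAddCommGroup F] [NormedSpace ℝ F] [FiniteDimensional ℝ F], Module.finrank
      ℝ F = 4 → ∀ (J : F → F →L[ℝ] F) (U : Set F), IsOpen U → ContDiffOn ℝ ((⊤ : ℕ∞) : WithTop ℕ∞)
      J U → (∀ x ∈ U, ∀ v : F, J x (J x v) = -v) → ∀ (u : ℂ → F) (z₀ : ℂ) (R : ℝ), 0 < R →
      ContDiffOn ℝ ((⊤ : ℕ∞) : WithTop ℕ∞) u (Metric.ball z₀ R) → Set.MapsTo u (Metric.ball z₀ R)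
      U → (∀ z ∈ Metric.ball z₀ R, ∀ α : ℂ, fderiv ℝ u z (Complex.I * α) = J (u z) (fderiv ℝ u z
      α)) → (∃ᶠ z in nhds z₀, u z ≠ u z₀) → ∃ (k : ℕ) (Θ : OpenPartialHomeomorph F (ℂ × ℂ)) (ξ :
      OpenPartialHomeomorph ℂ ℂ) (uhat : ℂ → ℂ) (ρ ρ₁ : ℝ), 0 < k ∧ 0 < ρ ∧ 0 < ρ₁ ∧ u z₀ ∈
      Θ.source ∧ Θ (u z₀) = 0 ∧ ContDiffOn ℝ ((⊤ : ℕ∞) : WithTop ℕ∞) Θ Θ.source ∧ ContDiffOn ℝ ((⊤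
      : ℕ∞) : WithTop ℕ∞) Θ.symm Θ.target ∧ Metric.ball z₀ ρ ⊆ ξ.source ∧ ξ z₀ = 0 ∧ ContDiffOn ℝ
      1 ξ ξ.source ∧ ContDiffOn ℝ 1 ξ.symm ξ.target ∧ ContDiffOn ℝ ((⊤ : ℕ∞) : WithTop ℕ∞) ξ
      (ξ.source \ {z₀}) ∧ Set.MapsTo ξ (Metric.ball z₀ ρ) (Metric.ball 0 ρ₁) ∧ ContDiffOn ℝ 1 uhat
      (Metric.ball 0 ρ₁) ∧ (uhat =O[nhds 0] fun w : ℂ => ‖w‖ ^ (k + 1)) ∧ (∀ z ∈ Metric.ball z₀ ρ,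
      u z ∈ Θ.source ∧ Θ (u z) = ((ξ z) ^ k, uhat (ξ z))) ∧ ∀ ℓ : ℕ, (∀ᶠ w in nhds (0 : ℂ), uhat
      (Complex.exp (2 * Real.pi * Complex.I * (ℓ / k : ℂ)) * w) = uhat w) ∨ ∃ (m : ℕ) (C : ℂ), k <
      m ∧ C ≠ 0 ∧ (fun w : ℂ => uhat (Complex.exp (2 * Real.pi * Complex.I * (ℓ / k : ℂ)) * w) -
      uhat w - C * w ^ m) =o[nhds (0 : ℂ)] fun w : ℂ => ‖w‖ ^ m) →
      Summit.SmoothPoincare4.SmoothPoincare4.Theses.SullivanDual.LimitOfEmbeddedPlanes :=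
  fun hX =>
    helper_limitOfEmbeddedPlanes_of_noCusp
      (CuspDoublePoints.jHolomorphic_immersed_of_limitEmbedded_punctured_of_representationFormula hX)

/-- **The crux modulo the promoted crux `PencilLocalFamily` and Wendl's representation formula.**
`Theses.SullivanDual.WitnessCharge` follows from `Theses.SullivanDual.PencilLocalFamily`
(stmt-SmoothPoincare4-16772; Wendl LNM 2216 Prop. 2.53 (`m = 1`)) and the local representation
formula with branch comparison (Wendl 2020, App. B, Thm B.23, (B.12); verbatim the `hX` of
`JHolomorphicCuspGlue.lean`), by reduction v9 and
`CuspDoublePoints.jHolomorphic_immersed_of_limitEmbedded_punctured_of_representationFormula`.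
Registered helper stub of crux stmt-SmoothPoincare4-7824. -/
theorem helper_witnessCharge_of_pencilLocalFamily_of_representationFormula :
    Summit.SmoothPoincare4.SmoothPoincare4.Theses.SullivanDual.PencilLocalFamily → (∀ (F : Type)
      [NormedAddCommGroup F] [NormedSpace ℝ F] [FiniteDimensional ℝ F], Module.finrank ℝ F = 4 → ∀
      (J : F → F →L[ℝ] F) (U : Set F), IsOpen U → ContDiffOn ℝ ((⊤ : ℕ∞) : WithTop ℕ∞) J U → (∀ x
      ∈ U, ∀ v : F, J x (J x v) = -v) → ∀ (u : ℂ → F) (z₀ : ℂ) (R : ℝ), 0 < R → ContDiffOn ℝ ((⊤ :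
      ℕ∞) : WithTop ℕ∞) u (Metric.ball z₀ R) → Set.MapsTo u (Metric.ball z₀ R) U → (∀ z ∈
      Metric.ball z₀ R, ∀ α : ℂ, fderiv ℝ u z (Complex.I * α) = J (u z) (fderiv ℝ u z α)) → (∃ᶠ z
      in nhds z₀, u z ≠ u z₀) → ∃ (k : ℕ) (Θ : OpenPartialHomeomorph F (ℂ × ℂ)) (ξ :
      OpenPartialHomeomorph ℂ ℂ) (uhat : ℂ → ℂ) (ρ ρ₁ : ℝ), 0 < k ∧ 0 < ρ ∧ 0 < ρ₁ ∧ u z₀ ∈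
      Θ.source ∧ Θ (u z₀) = 0 ∧ ContDiffOn ℝ ((⊤ : ℕ∞) : WithTop ℕ∞) Θ Θ.source ∧ ContDiffOn ℝ ((⊤
      : ℕ∞) : WithTop ℕ∞) Θ.symm Θ.target ∧ Metric.ball z₀ ρ ⊆ ξ.source ∧ ξ z₀ = 0 ∧ ContDiffOn ℝ
      1 ξ ξ.source ∧ ContDiffOn ℝ 1 ξ.symm ξ.target ∧ ContDiffOn ℝ ((⊤ : ℕ∞) : WithTop ℕ∞) ξ
      (ξ.source \ {z₀}) ∧ Set.MapsTo ξ (Metric.ball z₀ ρ) (Metric.ball 0 ρ₁) ∧ ContDiffOn ℝ 1 uhat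
      (Metric.ball 0 ρ₁) ∧ (uhat =O[nhds 0] fun w : ℂ => ‖w‖ ^ (k + 1)) ∧ (∀ z ∈ Metric.ball z₀ ρ,
      u z ∈ Θ.source ∧ Θ (u z) = ((ξ z) ^ k, uhat (ξ z))) ∧ ∀ ℓ : ℕ, (∀ᶠ w in nhds (0 : ℂ), uhat
      (Complex.exp (2 * Real.pi * Complex.I * (ℓ / k : ℂ)) * w) = uhat w) ∨ ∃ (m : ℕ) (C : ℂ), k <
      m ∧ C ≠ 0 ∧ (fun w : ℂ => uhat (Complex.exp (2 * Real.pi * Complex.I * (ℓ / k : ℂ)) * w) -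
      uhat w - C * w ^ m) =o[nhds (0 : ℂ)] fun w : ℂ => ‖w‖ ^ m) →
      Summit.SmoothPoincare4.SmoothPoincare4.Theses.SullivanDual.WitnessCharge :=
  fun hP hX =>
    helper_witnessCharge_of_pencilLocalFamily_of_noCusp hP
      (CuspDoublePoints.jHolomorphic_immersed_of_limitEmbedded_punctured_of_representationFormula hX)

end Summit.SmoothPoincare4.SmoothPoincare4.Theorems.WitnessCharge.PencilIncompleteness
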